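import Mathlib
import Summits.KontsevichZagierPeriods.KontsevichZagierPeriods.Theorems.InverseLandauTateFamilyKernelStubExactWall

/-!
# Crux `TateFamilyKernel` (stmt-KontsevichZagierPeriods-9130), line `Sketch` — stub `stub_descentOfExact`

CONSTRUCTOR: Griffiths-exact Tate families inhabit the research stub's normal form (`stub_descentTate`)
with NO auxiliary variable (`m = 0`). Given the family identity `c(ϖ) · P/Q = Σ_k ∂_{i_k}(A_k/D_k)`
on `[0,1]^{N+2} × (0,b)` (`c ∈ ℚ[ϖ] ∖ 0`, Tate admissible `D_k`, `Q` admissible, `∫ P/Q ≡ 0`) and a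
real-algebraic `ϖ₀ ∈ (0,b)`, wall absorption (`stub_exactWall`) provides fibre Griffiths data
`(A'_k, D'_k, i'_k)` regular on the closed cube at `ϖ₀` and ONE Tate boundary family `(P_b, Q_b)` of
dimension `N + 1`, admissible with vanishing integrals on `(0,b)`, whose fibre at `ϖ₀` is
`Σ_k [f_k(ι_k¹ x) − f_k(ι_k⁰ x)]`, `f_k = A'_k/D'_k`, `ι_k^β x = Fin.insertNth (i'_k) β x`. The three kinds:

* (a) the Ayoub elements of `(A'_k, D'_k, i'_k)`: `∂_{i'_k} f_k − f_k|_{w_{i'_k}=1} + f_k|_{w_{i'_k}=0}`;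
* (d) for each `k` and each face value `β ∈ {1, 0}` the hyperoctahedral difference `h − h ∘ g_k` with
  `h = ± f_k|_{w_{i'_k}=β}` (the polynomial substitution `X_{i'_k} ↦ β` in the SAME variables,
  `descentOfExact_aeval_faceFix`) and `g_k = (σ_k, ∅)`, `σ_k = KZ.RFun.toLast (i'_k)` (so that
  `(w ∘ σ_k with w_{i'_k} ↦ β) = ι_k^β (w ∘ Fin.castSucc)`, `descentOfExact_update_comp_toLast`);
* (e) ONE product: the boundary family `(P_b, Q_b)` placed by `Equiv.refl` with cofactor `1`.

The pointwise identity is bookkeeping: with `x = w ∘ Fin.castSucc`,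
`f¹ − f⁰ = (f¹ − f¹∘g) + (−f⁰ − (−f⁰∘g)) + (f¹∘g − f⁰∘g)` termwise, and `Σ_k` of the last bracket is the
fibre of `P_b/Q_b` at `x`. No named fact, no new definition.
-/

noncomputable section

open MeasureTheory Set MvPolynomial
open Literature.NumberTheory.Transcendental

namespace Summit.KontsevichZagierPeriods.InverseLandau.TateFamilyKernel.Descent

/-- **Face fixing in the same variables, evaluated.** Substituting `X_j ↦ β` (`j` a cube direction,
`β ∈ ℚ`) and keeping all other variables, then evaluating at `(w, ϖ)`, is evaluating at
`(w with w_j ↦ β, ϖ)`. [folklore] -/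
theorem descentOfExact_aeval_faceFix {n : ℕ} (j : Fin n) (β : ℚ) (P : MvPolynomial (Fin (n + 1)) ℚ)
    (w : Fin n → ℝ) (ϖ : ℝ) :
    aeval (Fin.snoc w ϖ : Fin (n + 1) → ℝ)
        (aeval (Function.update X (Fin.castSucc j) (C β) : Fin (n + 1) → MvPolynomial (Fin (n + 1)) ℚ) P) =
      aeval (Fin.snoc (Function.update w j (β : ℝ)) ϖ : Fin (n + 1) → ℝ) P := by
  have hv : (fun s => aeval (Fin.snoc w ϖ : Fin (n + 1) → ℝ)
      ((Function.update X (Fin.castSucc j) (C β) : Fin (n + 1) → MvPolynomial (Fin (n + 1)) ℚ) s)) =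
      (Fin.snoc (Function.update w j (β : ℝ)) ϖ : Fin (n + 1) → ℝ) := by
    funext s
    by_cases hs : s = Fin.castSucc j
    · subst hs
      rw [Function.update_self, Fin.snoc_castSucc, Function.update_self, aeval_C, eq_ratCast]
    · rw [Function.update_of_ne hs, aeval_X]
      refine Fin.lastCases ?_ (fun t => ?_) s hs
      · intro _
        rw [Fin.snoc_last, Fin.snoc_last]
      · intro ht
        rw [Fin.snoc_castSucc, Fin.snoc_castSucc,
          Function.update_of_ne (fun h => ht (congrArg Fin.castSucc h))]
  rw [← AlgHom.comp_apply, MvPolynomial.comp_aeval, hv]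

/-- **Reading a point along `toLast j`, then fixing `w_j`.** For `σ = KZ.RFun.toLast j` (the permutation
with `σ (j.succAbove t) = t.castSucc`, `σ j = last`), the point `(w ∘ σ with w_j ↦ β)` is the face point
`Fin.insertNth j β (w ∘ Fin.castSucc)`. [folklore] -/
theorem descentOfExact_update_comp_toLast {n : ℕ} (j : Fin (n + 1)) (w : Fin (n + 1) → ℝ) (β : ℝ) :
    Function.update (fun t => w (KZ.RFun.toLast j t)) j β =
      Fin.insertNth j β (fun t : Fin n => w (Fin.castSucc t)) := by
  funext s
  induction s using Fin.succAboveCases j with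
  | x => simp [Fin.insertNth_apply_same]
  | p s => simp [Fin.insertNth_apply_succAbove]

/-- **Exact families inhabit the Tate descent normal form** (stub `stub_descentOfExact` of the crux
`TateFamilyKernel`, line `Sketch`; CONSTRUCTOR, `m = 0`). If the Tate family `P/Q` (admissible,
vanishing on `(0,b)`) is Griffiths-exact at family level up to a scalar `c(ϖ) ∈ ℚ[ϖ] ∖ 0` with Tate
admissible denominators, then the `∃` of `stub_descentTate N` holds at every real-algebraic
`ϖ₀ ∈ (0,b)`: take `m = 0`; kind (a) = the fibre data `(A'_k, Dn'_k)` of `stub_exactWall` in directions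
`i'_k`; kind (d) = for each `k` and each face value `β ∈ {1,0}` the element `h − h∘g_k` with
`h = ± A'_k/Dn'_k` restricted to `w_{i'_k} = β` (denominator `Dn'_k|_{w_{i'_k}=β} ≠ 0` on the cube) and
`g_k = (KZ.RFun.toLast (i'_k), ∅)`; kind (e) = ONE product: the boundary Tate family `(Pb, Qb)` of
`stub_exactWall` (dimension `N + 1`, admissible and vanishing on `(0,b)`, placement `Equiv.refl`,
cofactor `1`), whose fibre at `ϖ₀` is `Σ_k [(A'/Dn')(insertNth (i'_k) 1 x) − (A'/Dn')(insertNth (i'_k) 0 x)]`,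
`x = w ∘ Fin.castSucc`. The pointwise identity is the telescoping
`f¹ − f⁰ = (f¹ − f¹∘g) + (−f⁰ + f⁰∘g) + (f¹∘g − f⁰∘g)`. [cite: KontsevichZagier2001, §1.2] -/
theorem stub_descentOfExact (N K0 : ℕ) (i0 : Fin K0 → Fin (N + 2)) (P Q : MvPolynomial (Fin (N + 2 + 1)) ℚ)
    (A0 Dn0 : Fin K0 → MvPolynomial (Fin (N + 2 + 1)) ℚ) (cpoly : Polynomial ℚ) (b : ℝ) (hb : 0 < b)
    (hcpoly : cpoly ≠ 0)
    (hT : ∃ c₀ : ℚ, c₀ ≠ 0 ∧ ∀ z : Fin (N + 2) → ℝ,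
      aeval (Fin.snoc z (0 : ℝ) : Fin (N + 2 + 1) → ℝ) Q = (c₀ : ℝ))
    (hadm : ∀ (z : Fin (N + 2) → ℝ) (ϖ : ℝ), (∀ t, z t ∈ Icc (0 : ℝ) 1) → ϖ ∈ Ioo 0 b →
      aeval (Fin.snoc z ϖ : Fin (N + 2 + 1) → ℝ) Q ≠ 0)
    (hvan : ∀ ϖ ∈ Ioo 0 b, ∫ z in Set.pi Set.univ (fun _ : Fin (N + 2) => Ioo (0 : ℝ) 1),
      aeval (Fin.snoc z ϖ : Fin (N + 2 + 1) → ℝ) P / aeval (Fin.snoc z ϖ : Fin (N + 2 + 1) → ℝ) Q = 0)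
    (hTD : ∀ k, ∃ c₀ : ℚ, c₀ ≠ 0 ∧ ∀ w : Fin (N + 2) → ℝ,
      aeval (Fin.snoc w (0 : ℝ) : Fin (N + 2 + 1) → ℝ) (Dn0 k) = (c₀ : ℝ))
    (hadmD : ∀ k (w : Fin (N + 2) → ℝ) (ϖ : ℝ), (∀ t, w t ∈ Icc (0 : ℝ) 1) → ϖ ∈ Ioo 0 b →
      aeval (Fin.snoc w ϖ : Fin (N + 2 + 1) → ℝ) (Dn0 k) ≠ 0)
    (hexact : ∀ ϖ ∈ Ioo 0 b, ∀ w ∈ KZ.cube (N + 2),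
      (Polynomial.aeval ϖ cpoly : ℝ) *
          (aeval (Fin.snoc w ϖ : Fin (N + 2 + 1) → ℝ) P / aeval (Fin.snoc w ϖ : Fin (N + 2 + 1) → ℝ) Q) =
        ∑ k, aeval (Fin.snoc w ϖ : Fin (N + 2 + 1) → ℝ)
            (pderiv (Fin.castSucc (i0 k)) (A0 k) * Dn0 k - A0 k * pderiv (Fin.castSucc (i0 k)) (Dn0 k)) /
          aeval (Fin.snoc w ϖ : Fin (N + 2 + 1) → ℝ) (Dn0 k ^ 2))
    (ϖ₀ : ℝ) (halg : IsAlgebraic ℚ ϖ₀) (hϖ₀ : ϖ₀ ∈ Ioo 0 b) :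
    ∃ (m K : ℕ) (A Dn : Fin K → MvPolynomial (Fin (N + 2 + m + 1)) ℚ) (i : Fin K → Fin (N + 2 + m))
        (L : ℕ) (B E : Fin L → MvPolynomial (Fin (N + 2 + m + 1)) ℚ)
        (σ : Fin L → Equiv.Perm (Fin (N + 2 + m))) (S : Fin L → Finset (Fin (N + 2 + m)))
        (J : ℕ) (d c : Fin J → ℕ) (e : ∀ j, Fin (d j + c j) ≃ Fin (N + 2 + m))
        (Pj Qj : ∀ j, MvPolynomial (Fin (d j + 1)) ℚ) (bj : Fin J → ℝ)
        (Bj Ej : ∀ j, MvPolynomial (Fin (c j + 1)) ℚ),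
        (∀ k, ∀ w ∈ KZ.cube (N + 2 + m), aeval (Fin.snoc w ϖ₀ : Fin (N + 2 + m + 1) → ℝ) (Dn k) ≠ 0) ∧
        (∀ l, ∀ w ∈ KZ.cube (N + 2 + m), aeval (Fin.snoc w ϖ₀ : Fin (N + 2 + m + 1) → ℝ) (E l) ≠ 0) ∧
        (∀ j, d j ≤ N + 1) ∧
        (∀ j, ∃ c₀ : ℚ, c₀ ≠ 0 ∧ ∀ y : Fin (d j) → ℝ,
          aeval (Fin.snoc y (0 : ℝ) : Fin (d j + 1) → ℝ) (Qj j) = (c₀ : ℝ)) ∧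
        (∀ j (y : Fin (d j) → ℝ) (ϖ : ℝ), (∀ t, y t ∈ Icc (0 : ℝ) 1) → ϖ ∈ Ioo 0 (bj j) →
          aeval (Fin.snoc y ϖ : Fin (d j + 1) → ℝ) (Qj j) ≠ 0) ∧
        (∀ j, ∀ ϖ ∈ Ioo 0 (bj j), ∫ y in Set.pi Set.univ (fun _ : Fin (d j) => Ioo (0 : ℝ) 1),
          aeval (Fin.snoc y ϖ : Fin (d j + 1) → ℝ) (Pj j) / aeval (Fin.snoc y ϖ : Fin (d j + 1) → ℝ) (Qj j) = 0) ∧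
        (∀ j, ϖ₀ ∈ Ioo 0 (bj j)) ∧
        (∀ j, ∀ y ∈ KZ.cube (c j), aeval (Fin.snoc y ϖ₀ : Fin (c j + 1) → ℝ) (Ej j) ≠ 0) ∧
        (∀ w ∈ KZ.cube (N + 2 + m),
          aeval (Fin.snoc (fun t => w (Fin.castAdd m t)) ϖ₀ : Fin (N + 2 + 1) → ℝ) P /
              aeval (Fin.snoc (fun t => w (Fin.castAdd m t)) ϖ₀ : Fin (N + 2 + 1) → ℝ) Q =
            (∑ k : Fin K,
              (aeval (Fin.snoc w ϖ₀ : Fin (N + 2 + m + 1) → ℝ)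
                  (pderiv (Fin.castSucc (i k)) (A k) * Dn k - A k * pderiv (Fin.castSucc (i k)) (Dn k)) /
                aeval (Fin.snoc w ϖ₀ : Fin (N + 2 + m + 1) → ℝ) (Dn k ^ 2)
              - aeval (Fin.snoc (Function.update w (i k) 1) ϖ₀ : Fin (N + 2 + m + 1) → ℝ) (A k) /
                  aeval (Fin.snoc (Function.update w (i k) 1) ϖ₀ : Fin (N + 2 + m + 1) → ℝ) (Dn k)
              + aeval (Fin.snoc (Function.update w (i k) 0) ϖ₀ : Fin (N + 2 + m + 1) → ℝ) (A k) /
                  aeval (Fin.snoc (Function.update w (i k) 0) ϖ₀ : Fin (N + 2 + m + 1) → ℝ) (Dn k))) +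
            (∑ l : Fin L,
              (aeval (Fin.snoc w ϖ₀ : Fin (N + 2 + m + 1) → ℝ) (B l) /
                  aeval (Fin.snoc w ϖ₀ : Fin (N + 2 + m + 1) → ℝ) (E l) -
                aeval (Fin.snoc (fun t => if t ∈ S l then 1 - w (σ l t) else w (σ l t)) ϖ₀ :
                    Fin (N + 2 + m + 1) → ℝ) (B l) /
                  aeval (Fin.snoc (fun t => if t ∈ S l then 1 - w (σ l t) else w (σ l t)) ϖ₀ :
                    Fin (N + 2 + m + 1) → ℝ) (E l))) +
            (∑ j : Fin J,
              aeval (Fin.snoc (fun t => w (e j (Fin.castAdd (c j) t))) ϖ₀ : Fin (d j + 1) → ℝ) (Pj j) /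
                  aeval (Fin.snoc (fun t => w (e j (Fin.castAdd (c j) t))) ϖ₀ : Fin (d j + 1) → ℝ) (Qj j) *
                (aeval (Fin.snoc (fun t => w (e j (Fin.natAdd (d j) t))) ϖ₀ : Fin (c j + 1) → ℝ) (Bj j) /
                  aeval (Fin.snoc (fun t => w (e j (Fin.natAdd (d j) t))) ϖ₀ : Fin (c j + 1) → ℝ) (Ej j)))) := by
  have _ := hT
  /- Step 1: wall absorption at `ϖ₀` (`stub_exactWall`, with `ε = b`). -/
  obtain ⟨K', i', A', Dn', Pb, Qb, hDn', hbT, hbadm, hbval, hbvan, hfib⟩ :=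
    stub_exactWall N K0 i0 P Q A0 Dn0 cpoly b hb hcpoly hTD hadmD hadm hvan hexact ϖ₀ halg hϖ₀
  /- Step 2: the face-fixing substitutions `φ j β : X_j ↦ β` and the kind-(d) data. -/
  obtain ⟨φ, hφ⟩ : ∃ φ : Fin (N + 2) → ℚ →
      (MvPolynomial (Fin (N + 2 + 1)) ℚ →ₐ[ℚ] MvPolynomial (Fin (N + 2 + 1)) ℚ),
      ∀ j β, φ j β = aeval (Function.update X (Fin.castSucc j) (C β)) := ⟨_, fun _ _ => rfl⟩
  have hφev : ∀ (j : Fin (N + 2)) (β : ℚ) (R : MvPolynomial (Fin (N + 2 + 1)) ℚ) (w : Fin (N + 2) → ℝ),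
      aeval (Fin.snoc w ϖ₀ : Fin (N + 2 + 1) → ℝ) (φ j β R) =
        aeval (Fin.snoc (Function.update w j (β : ℝ)) ϖ₀ : Fin (N + 2 + 1) → ℝ) R := by
    intro j β R w
    rw [hφ]
    exact descentOfExact_aeval_faceFix j β R w ϖ₀
  obtain ⟨B, hB⟩ : ∃ B : Fin (K' + K') → MvPolynomial (Fin (N + 2 + 1)) ℚ,
      B = Fin.append (fun k => φ (i' k) 1 (A' k)) (fun k => -φ (i' k) 0 (A' k)) := ⟨_, rfl⟩
  obtain ⟨E, hE⟩ : ∃ E : Fin (K' + K') → MvPolynomial (Fin (N + 2 + 1)) ℚ,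
      E = Fin.append (fun k => φ (i' k) 1 (Dn' k)) (fun k => φ (i' k) 0 (Dn' k)) := ⟨_, rfl⟩
  obtain ⟨σ, hσ⟩ : ∃ σ : Fin (K' + K') → Equiv.Perm (Fin (N + 2)),
      σ = Fin.append (fun k => KZ.RFun.toLast (i' k)) (fun k => KZ.RFun.toLast (i' k)) := ⟨_, rfl⟩
  /- Step 3: faces of the cube lie in the cube. -/
  have hupd : ∀ (w : Fin (N + 2) → ℝ), w ∈ KZ.cube (N + 2) → ∀ (j : Fin (N + 2)) (β : ℚ),
      (β = 1 ∨ β = 0) → Function.update w j (β : ℝ) ∈ KZ.cube (N + 2) := by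
    rintro w hw j β (rfl | rfl)
    · simpa only [Rat.cast_one] using KZ.update_mem_cube hw j zero_le_one le_rfl
    · simpa only [Rat.cast_zero] using KZ.update_mem_cube hw j le_rfl zero_le_one
  refine ⟨0, K', A', Dn', i', K' + K', B, E, σ, fun _ => ∅, 1, fun _ => N + 1, fun _ => 1,
    fun _ => Equiv.refl _, fun _ => Pb, fun _ => Qb, fun _ => b, fun _ => 1, fun _ => 1,
    hDn', ?_, fun _ => le_rfl, fun _ => hbT, fun _ => hbadm, fun _ => hbvan, fun _ => hϖ₀, ?_, ?_⟩
  · /- kind (d): the denominators `Dn'_k|_{w_{i'_k}=β}` do not vanish on the cube at `ϖ₀`. -/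
    intro l w hw
    dsimp only [Nat.add_zero] at w hw ⊢
    refine Fin.addCases (fun k => ?_) (fun k => ?_) l
    · rw [hE, Fin.append_left, hφev]
      exact hDn' k _ (hupd w hw (i' k) 1 (Or.inl rfl))
    · rw [hE, Fin.append_right, hφev]
      exact hDn' k _ (hupd w hw (i' k) 0 (Or.inr rfl))
  · /- kind (e): the cofactor `1` does not vanish. -/
    intro _ y _
    rw [map_one]
    exact one_ne_zero
  · /- The pointwise identity. -/
    intro w hw
    dsimp only [Nat.add_zero] at w hw ⊢
    have hx : (fun t : Fin (N + 1) => w (Fin.castSucc t)) ∈ KZ.cube (N + 1) :=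
      KZ.mem_cube.2 fun t => KZ.mem_cube.1 hw _
    have hca : ∀ t : Fin (N + 1), (Fin.castAdd 1 t : Fin (N + 1 + 1)) = Fin.castSucc t := fun _ => rfl
    have hc0 : ∀ t : Fin (N + 2), (Fin.castAdd 0 t : Fin (N + 2)) = t := fun _ => rfl
    simp only [hc0, hca, Equiv.refl_apply, Fintype.sum_unique, map_one, div_one, mul_one,
      Finset.notMem_empty, if_false, Fin.sum_univ_add, hB, hE, hσ, Fin.append_left, Fin.append_right,
      hφev, map_neg, Rat.cast_one, Rat.cast_zero, descentOfExact_update_comp_toLast]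
    rw [hfib w hw, hbval _ hx]
    simp only [← Finset.sum_add_distrib]
    refine Finset.sum_congr rfl fun k _ => ?_
    ring

end Summit.KontsevichZagierPeriods.InverseLandau.TateFamilyKernel.Descent
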